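import Literature.Probability.RandomPlanarGeometry.HexSAWPolygonStepTwoFourSlot
import Literature.Probability.RandomPlanarGeometry.HexSAWPolygonStepTwoFloorCrown
import HarnessLib

/-!
# The step `2` for honeycomb polygon numbers: the SIX-SLOT injection
# `#{X ∪ Y⋆ ∪ (leaf ∩ bottom-served) ∪ slide ∪ (crown ∩ bottom-leaf) ∪ (floor-slide ∩ top-leaf) ∪ (floor-crown ∩ top-antenna)} ≤ q_{N+2}(ℍ)`

Topic `Literature/Probability/RandomPlanarGeometry` (lane «pcv-sawmu», a-p4 g20; assembly of `HexSAWPolygonStepTwoFourSlot.lean` (two corners,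
leaf slide, leaf crown), `HexSAWPolygonStepTwoFloorSlide.lean` (floor slide: `IsFloorSlide`, `FloorSlideDatum`, `exists_floorSlide_image`,
`eq_of_floorSlide_image_eq`, `isTopLeaf_of_floorSlideDatum`, `not_isBotLeaf_spliceUb`, `spliceUb_ne_bottom`) and
`HexSAWPolygonStepTwoFloorCrown.lean` (floor crown: `IsFloorCrown`, `FloorCrownDatum`, `exists_floorCrown_image`, `eq_of_floorCrown_image_eq`,
`isTopLeaf_of_floorCrownDatum`, `isBotLeaf_spliceVb`)).

The six kinds of images are pairwise distinct: by the top-leaf bit (top images and slide images are not top-leaf, the other four are), by the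
bottom-leaf bit (bottom images and floor-slide images are not bottom-leaf; crown and floor-crown images are), by the data (`spliceU_ne_roof`:
slide vs top; `spliceUb_ne_bottom`: floor-slide vs bottom), and — for crown against floor-crown images, both top-leaf and bottom-leaf — by
ONE SITE: a crown image avoids the site `(x′−3, H′−2)` three columns left and two rows below its top corner (`spliceV_free_mid`: it is the
vertex under the filled gap), while a floor-crown image of a polygon whose top is a DOMINO ANTENNA (the top-right leaf's support hexagon has no
left neighbour: the site `(xm−3, H−2)` is on the walk — class `IsTopAntenna`) keeps that site (`antenna_topSix_of_floorCrownDatum`).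
★ **`card_filter_isStepTwoSixSlot_le : 5 ≤ n → #{ω ∈ canonEnd n | IsStepTwoSixSlot n ω} ≤ #canonEnd (n+2)`** with
`IsStepTwoSixSlot n ω := IsStepTwoFourSlot n ω ∨ (IsFloorSlide n ω ∧ IsTopLeaf n ω) ∨ (IsFloorCrown n ω ∧ IsTopAntenna n ω)`; complement
and printed forms.

NOT claimed: `q_N(ℍ) ≤ q_{N+2}(ℍ)`.  Numerically (`HOME/pub-sawmu-a-p4/g20/three/py/slideUV2.py` with the class conditions of the five files)
the six-slot residue is `1, 0, 2, 1, 6, 7, 26, 51, 172` of `12, 18, 65, 138, 432, 1074, 3231, 8718, 25 999` for `N = 14, …, 30` (≈ 0.66 %, from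
≈ 2.5 % for the two corners this morning): the polygons whose top-right AND bottom-right hexagons are leaves on support runs of length one
(`149` at `N = 30`), plus `22` floor-slide candidates with `xb = 5` (root-unsafe without re-rooting) and one three-row floor-crown candidate.
Label (lane): LANE LEMMA / infrastructure for an open combinatorial item; no literature claim beyond the transplanted `ℤ^d` method.
-/

noncomputable section

open Finset Function Literature.Probability.LatticeModels Literature.Probability.Percolation SimpleGraph

namespace Literature.Probability.RandomPlanarGeometry.SAW

namespace HexBW

namespace PolygonConcat

variable {n : ℕ} {ω : ℕ → Site 2}

section SixSlot

/-- **A crown image avoids the site `(xm−2, H−1)`** (the vertex under the filled gap, an interior vertex of the image): the new path misses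
it and on `ω` it is a window site met by no time outside the window. [cite: MadrasSlade1993, §3.2 (proof of Theorem 3.2.3)] -/
theorem spliceV_free_mid {xm H : ℤ} {fwd : Bool} {j : ℕ} (hω : ω ∈ endAt n (Pi.single 0 1 : Site 2))
    (hP : SpliceAddOK n 2 7 ω j (tpath offV 9 xm H fwd)) (hw : ∀ s, s ≤ 7 → ω (j + s) = tpath wV 7 xm H fwd s) :
    ∀ t, t ≤ n + 2 → spliceAdd 2 7 ω (tpath offV 9 xm H fwd) j t ≠ pt (xm - 2) (H - 1) := by
  have hinj := (mem_endAt_iff.1 hω).1.2.2.2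
  have hwnd := hP.wnd
  intro t ht he
  rcases spliceAdd_site_cases hP ht with ⟨a, ha, hao, hta⟩ | ⟨s, hs, hts⟩
  · -- `(xm−2, H−1)` is `ω (j + rd fwd 7 3)`
    have e1 : ω (j + rd fwd 7 3) = pt (xm - 2) (H - 1) := by
      rw [hw _ (rd_le (by norm_num)), tpath]
      have : rd fwd 7 (rd fwd 7 3) = 3 := by unfold rd; split_ifs <;> omega
      rw [this]; simp only [wV]; exact pt_inj.2 ⟨by ring, by ring⟩
    rw [hta] at he
    have := hinj (show a ∈ {i | i ≤ n} by simpa using ha)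
      (show j + rd fwd 7 3 ∈ {i | i ≤ n} by simp; unfold rd; split_ifs <;> omega) (by rw [he, e1])
    have hr : 0 < rd fwd 7 3 ∧ rd fwd 7 3 < 7 := by unfold rd; split_ifs <;> omega
    omega
  · rw [hts, tpath] at he
    obtain ⟨e1, e2⟩ := pt_inj.1 he
    have hr := rd_le (fwd := fwd) hs
    generalize rd fwd 9 s = u at e1 e2 hr
    interval_cases u <;> simp only [offV] at e1 e2 <;> omega

/-- **The top-antenna class**: a top-right LEAF (data of `IsTopLeaf`) whose support hexagon has no left neighbour — recorded by the presence
on `ω` of the site `(xm−3, H−2)` (the bottom-left vertex of the support hexagon; it is a boundary vertex whenever the hexagon left of the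
support is absent).  Every polygon of the four-slot residue is of this class.
[cite: MadrasSlade1993, §3.2 (proof of Theorem 3.2.3: the local structure at the lexicographically largest point)] -/
def IsTopAntenna (n : ℕ) (ω : ℕ → Site 2) : Prop :=
  ∃ (H xm : ℤ) (i₀ : ℕ), i₀ + 1 ≤ n ∧ ω i₀ = pt xm H ∧ 2 ≤ xm ∧
    (∀ i, i ≤ n → ω i 1 ≤ H) ∧ (∀ i, i ≤ n → ω i 1 = H → ω i 0 ≤ xm) ∧ (∀ t, t ≤ n → ω t ≠ pt (xm - 3) H) ∧
    ((i₀ + 2 ≤ n ∧ ω (i₀ + 1) = pt xm (H - 1) ∧ ω (i₀ + 2) = pt (xm - 1) (H - 1)) ∨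
      (2 ≤ i₀ ∧ ω (i₀ - 1) = pt xm (H - 1) ∧ ω (i₀ - 2) = pt (xm - 1) (H - 1))) ∧
    (∃ t, t ≤ n ∧ ω t = pt (xm - 3) (H - 2))

/-- A top antenna is a top leaf. [cite: MadrasSlade1993, §3.2 (proof of Theorem 3.2.3)] -/
theorem isTopLeaf_of_isTopAntenna (h : IsTopAntenna n ω) : IsTopLeaf n ω := by
  obtain ⟨H, xm, i₀, hi₀n, hv, hx2, hmaxH, hmaxX, hX3, hpat, -⟩ := h
  exact ⟨H, xm, i₀, hi₀n, hv, hx2, hmaxH, hmaxX, hX3, hpat⟩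

/-- **The antenna's marked site survives the floor crown**: for a floor-crown image of a top antenna (on a polygon with a site of height
`≥ L + 4`), the image's intrinsic top corner is the old one and the site `(xm−3, H−2)` is still on the image (both have height `> L + 1`, above
the open window and the interior new sites). [cite: MadrasSlade1993, §3.2 (proof of Theorem 3.2.3)] -/
theorem antenna_topSix_of_floorCrownDatum {W : ℕ → Site 2} {L xb : ℤ} {j : ℕ} {fwd : Bool}
    (hd : FloorCrownDatum n ω W L xb j fwd) (hdepth : ∃ i, i ≤ n ∧ L + 4 ≤ ω i 1) (ha : IsTopAntenna n ω) :
    ∃ (H xm : ℤ) (τ t : ℕ), TopSix (n + 2) W H xm τ ∧ t ≤ n + 2 ∧ W t = pt (xm - 3) (H - 2) := by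
  obtain ⟨-, hP, hw, rfl⟩ := hd
  obtain ⟨i₁, hi₁, hdp⟩ := hdepth
  obtain ⟨H, xm, i₀, hi₀n, hv, -, hmaxH, hmaxX, -, -, t, ht, hωt⟩ := ha
  have hwnd := hP.wnd
  have hHL : L + 4 ≤ H := le_trans hdp (hmaxH i₁ hi₁)
  -- interior new sites and open-window sites have height `≤ L + 1`
  have hπ : ∀ s, 0 < s → s < 7 + 2 → (tpath offVb 9 xb L fwd s) 1 ≤ L + 1 := by
    intro s hs0 hs1
    rw [tpath, pt_apply_one]
    have hr : 0 < rd fwd 9 s ∧ rd fwd 9 s < 9 := by unfold rd; split_ifs <;> omega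
    generalize rd fwd 9 s = u at hr
    obtain ⟨hr0, hr1⟩ := hr
    interval_cases u <;> simp [offVb]
  have hwin : ∀ s, 0 < s → s < 7 → ω (j + s) 1 ≤ L + 1 := by
    intro s hs0 hs1
    rw [hw s (by omega), tpath, pt_apply_one]
    have hr : 0 < rd fwd 7 s ∧ rd fwd 7 s < 7 := by unfold rd; split_ifs <;> omega
    generalize rd fwd 7 s = u at hr
    obtain ⟨hr0, hr1⟩ := hr
    interval_cases u <;> simp [wVb]
  -- every image site is an old site or has height `≤ L + 1`
  have site : ∀ i, i ≤ n + 2 → (∃ a, a ≤ n ∧ spliceAdd 2 7 ω (tpath offVb 9 xb L fwd) j i = ω a) ∨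
      spliceAdd 2 7 ω (tpath offVb 9 xb L fwd) j i 1 ≤ L + 1 := by
    intro i hi
    rcases spliceAdd_site_cases hP hi with ⟨a, ha, -, e⟩ | ⟨s, hs, e⟩
    · exact Or.inl ⟨a, ha, e⟩
    · rcases Nat.eq_zero_or_pos s with rfl | hs0
      · exact Or.inl ⟨j, by omega, by rw [e, hP.start]⟩
      · rcases eq_or_lt_of_le hs with hsL | hsL
        · exact Or.inl ⟨j + 7, by omega, by rw [e, hsL, hP.finish]⟩
        · exact Or.inr (by rw [e]; exact hπ s hs0 hsL)
  -- an old site of height `> L + 1` is on the image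
  have keep : ∀ a, a ≤ n → L + 1 < ω a 1 → ∃ t', t' ≤ n + 2 ∧ spliceAdd 2 7 ω (tpath offVb 9 xb L fwd) j t' = ω a := by
    intro a ha hah
    rcases le_or_gt a j with h1 | h1
    · exact ⟨a, by omega, spliceAdd_of_le h1⟩
    · have h2 : j + 7 ≤ a := by
        by_contra hcon
        push Not at hcon
        obtain ⟨s, rfl⟩ : ∃ s, a = j + s := ⟨a - j, by omega⟩
        have := hwin s (by omega) (by omega); omega
      exact ⟨a + 2, by omega, by rw [spliceAdd_of_ge hP.finish (by omega), show a + 2 - 2 = a by omega]⟩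
  obtain ⟨τ, hτ, eτ⟩ := keep i₀ (by omega) (by rw [hv]; simp; omega)
  obtain ⟨t', ht', et'⟩ := keep t ht (by rw [hωt]; simp; omega)
  refine ⟨H, xm, τ, t', ⟨fun i hi => ?_, fun i hi hiH => ?_, hτ, by rw [eτ, hv]⟩, ht', by rw [et', hωt]⟩
  · rcases site i hi with ⟨a, ha, e⟩ | h
    · rw [e]; exact hmaxH a ha
    · omega
  · rcases site i hi with ⟨a, ha, e⟩ | h
    · rw [e] at hiH ⊢; exact hmaxX a ha hiH
    · omega

/-- **The class served by the six slots**: the four-slot class, floor-slide ∧ top-leaf, or floor-crown ∧ top-antenna.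
[cite: MadrasSlade1993, §3.2 (proof of Theorem 3.2.3)] -/
def IsStepTwoSixSlot (n : ℕ) (ω : ℕ → Site 2) : Prop :=
  IsStepTwoFourSlot n ω ∨ (IsFloorSlide n ω ∧ IsTopLeaf n ω) ∨ (IsFloorCrown n ω ∧ IsTopAntenna n ω)

/-- The six-slot class contains the four-slot class. [cite: MadrasSlade1993, §3.2 (proof of Theorem 3.2.3)] -/
theorem isStepTwoSixSlot_of_isStepTwoFourSlot (h : IsStepTwoFourSlot n ω) : IsStepTwoSixSlot n ω := Or.inl h

/-- **★ The step two holds on the six-slot class**: the canonical rooted `(n+1)`-gons (`n ≥ 5`) of the six-slot class inject into the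
canonical rooted `(n+3)`-gons. [cite: MadrasSlade1993, §3.2, Theorem 3.2.3 / (3.2.3) (the `ℤ^d` statement being transplanted)] -/
theorem card_filter_isStepTwoSixSlot_le [DecidablePred (IsStepTwoSixSlot n)] (hn : 5 ≤ n) :
    #((canonEnd n).filter (IsStepTwoSixSlot n)) ≤ #(canonEnd (n + 2)) := by
  classical
  let P1 : (ℕ → Site 2) → Prop := fun ω => ω ∈ canonEnd n ∧ IsStepTwoRoof n ω
  let P2 : (ℕ → Site 2) → Prop := fun ω => ω ∈ canonEnd n ∧ IsTopLeaf n ω ∧ IsStepTwoBottom n ω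
  let P3 : (ℕ → Site 2) → Prop := fun ω => ω ∈ canonEnd n ∧ IsLeafSlide n ω
  let P4 : (ℕ → Site 2) → Prop := fun ω => ω ∈ canonEnd n ∧ IsLeafCrown n ω ∧ IsBotLeaf n ω
  let P5 : (ℕ → Site 2) → Prop := fun ω => ω ∈ canonEnd n ∧ IsFloorSlide n ω ∧ IsTopLeaf n ω
  let P6 : (ℕ → Site 2) → Prop := fun ω => ω ∈ canonEnd n ∧ IsFloorCrown n ω ∧ IsTopAntenna n ω
  let E : (ℕ → Site 2) → (ℕ → Site 2) := fun ω =>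
    if h : P1 ω then Classical.choose (exists_stepTwoRoof_image h.1 hn h.2)
    else if h' : P2 ω then Classical.choose (exists_stepTwoBottom_image h'.1 hn h'.2.2)
    else if h3 : P3 ω then Classical.choose (exists_leafSlide_image h3.1 h3.2)
    else if h4 : P4 ω then Classical.choose (exists_leafCrown_image h4.1 h4.2.1)
    else if h5 : P5 ω then Classical.choose (exists_floorSlide_image h5.1 h5.2.1)
    else if h6 : P6 ω then Classical.choose (exists_floorCrown_image h6.1 h6.2.1)
    else ω
  have hE1 : ∀ ω (h : P1 ω), E ω = Classical.choose (exists_stepTwoRoof_image h.1 hn h.2) := fun ω h => dif_pos h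
  have hE2 : ∀ ω, ¬ P1 ω → ∀ h' : P2 ω, E ω = Classical.choose (exists_stepTwoBottom_image h'.1 hn h'.2.2) := by
    intro ω h1 h'
    show (if h : P1 ω then _ else _) = _
    rw [dif_neg h1, dif_pos h']
  have hE3 : ∀ ω, ¬ P1 ω → ¬ P2 ω → ∀ h3 : P3 ω, E ω = Classical.choose (exists_leafSlide_image h3.1 h3.2) := by
    intro ω h1 h2 h3
    show (if h : P1 ω then _ else _) = _
    rw [dif_neg h1, dif_neg h2, dif_pos h3]
  have hE4 : ∀ ω, ¬ P1 ω → ¬ P2 ω → ¬ P3 ω → ∀ h4 : P4 ω,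
      E ω = Classical.choose (exists_leafCrown_image h4.1 h4.2.1) := by
    intro ω h1 h2 h3 h4
    show (if h : P1 ω then _ else _) = _
    rw [dif_neg h1, dif_neg h2, dif_neg h3, dif_pos h4]
  have hE5 : ∀ ω, ¬ P1 ω → ¬ P2 ω → ¬ P3 ω → ¬ P4 ω → ∀ h5 : P5 ω,
      E ω = Classical.choose (exists_floorSlide_image h5.1 h5.2.1) := by
    intro ω h1 h2 h3 h4 h5
    show (if h : P1 ω then _ else _) = _
    rw [dif_neg h1, dif_neg h2, dif_neg h3, dif_neg h4, dif_pos h5]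
  have hE6 : ∀ ω, ¬ P1 ω → ¬ P2 ω → ¬ P3 ω → ¬ P4 ω → ¬ P5 ω → ∀ h6 : P6 ω,
      E ω = Classical.choose (exists_floorCrown_image h6.1 h6.2.1) := by
    intro ω h1 h2 h3 h4 h5 h6
    show (if h : P1 ω then _ else _) = _
    rw [dif_neg h1, dif_neg h2, dif_neg h3, dif_neg h4, dif_neg h5, dif_pos h6]
  -- the six kinds of images
  have himgR : ∀ ω (h : P1 ω), E ω ∈ canonEnd (n + 2) ∧ ¬ IsTopLeaf (n + 2) (E ω) ∧
      ∃ (H xm : ℤ) (j k : ℕ) (fwd : Bool), (∀ i, i ≤ n → ω i 1 ≤ H) ∧ (∀ i, i ≤ n → ω i 1 = H → ω i 0 ≤ xm) ∧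
        RoofDatum n ω (E ω) H xm j k fwd := by
    intro ω h
    rw [hE1 ω h]
    obtain ⟨hW, H, xm, j, k, fwd, hmaxH, hmaxX, hd⟩ := Classical.choose_spec (exists_stepTwoRoof_image h.1 hn h.2)
    exact ⟨hW, not_isTopLeaf_of_roofDatum h.1 (by omega) hmaxH hmaxX hd, H, xm, j, k, fwd, hmaxH, hmaxX, hd⟩
  have himgB : ∀ ω, ¬ P1 ω → ∀ h' : P2 ω, E ω ∈ canonEnd (n + 2) ∧ IsTopLeaf (n + 2) (E ω) ∧ ¬ IsBotLeaf (n + 2) (E ω) ∧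
      ∃ (L xb : ℤ) (j k : ℕ) (fwd : Bool), (∀ i, i ≤ n → L ≤ ω i 1) ∧ (∀ i, i ≤ n → ω i 1 = L → ω i 0 ≤ xb) ∧
        BottomDatum n ω (E ω) L xb j k fwd := by
    intro ω h1 h'
    rw [hE2 ω h1 h']
    obtain ⟨hW, L, xb, j, k, fwd, hminH, hmaxX, hd⟩ :=
      Classical.choose_spec (exists_stepTwoBottom_image h'.1 hn h'.2.2)
    exact ⟨hW, isTopLeaf_of_bottomDatum h'.1 hd h'.2.1, not_isBotLeaf_of_bottomDatum h'.1 hminH hmaxX hd,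
      L, xb, j, k, fwd, hminH, hmaxX, hd⟩
  have himgS : ∀ ω, ¬ P1 ω → ¬ P2 ω → ∀ h3 : P3 ω, E ω ∈ canonEnd (n + 2) ∧ ¬ IsTopLeaf (n + 2) (E ω) ∧
      ∃ (H xm : ℤ) (j : ℕ) (fwd : Bool), (∀ i, i ≤ n → ω i 1 ≤ H) ∧ (∀ i, i ≤ n → ω i 1 = H → ω i 0 ≤ xm) ∧
        SlideDatum n ω (E ω) H xm j fwd := by
    intro ω h1 h2 h3
    rw [hE3 ω h1 h2 h3]
    obtain ⟨hW, H, xm, j, fwd, hmaxH, hmaxX, hd⟩ := Classical.choose_spec (exists_leafSlide_image h3.1 h3.2)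
    refine ⟨hW, ?_, H, xm, j, fwd, hmaxH, hmaxX, hd⟩
    obtain ⟨hP, -, hWeq⟩ := hd
    rw [hWeq]; exact not_isTopLeaf_spliceU h3.1 hmaxH hmaxX hP
  have himgC : ∀ ω, ¬ P1 ω → ¬ P2 ω → ¬ P3 ω → ∀ h4 : P4 ω,
      E ω ∈ canonEnd (n + 2) ∧ IsTopLeaf (n + 2) (E ω) ∧ IsBotLeaf (n + 2) (E ω) ∧
      ∃ (H xm : ℤ) (j : ℕ) (fwd : Bool), (∀ i, i ≤ n → ω i 1 ≤ H) ∧ (∀ i, i ≤ n → ω i 1 = H → ω i 0 ≤ xm) ∧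
        CrownDatum n ω (E ω) H xm j fwd := by
    intro ω h1 h2 h3 h4
    rw [hE4 ω h1 h2 h3 h4]
    obtain ⟨hW, H, xm, j, fwd, hmaxH, hmaxX, hdepth, hd⟩ := Classical.choose_spec (exists_leafCrown_image h4.1 h4.2.1)
    refine ⟨hW, ?_, isBotLeaf_of_crownDatum hd hdepth h4.2.2, H, xm, j, fwd, hmaxH, hmaxX, hd⟩
    obtain ⟨hx2, hP, -, hWeq⟩ := hd
    rw [hWeq]; exact isTopLeaf_spliceV hx2 hmaxH hmaxX hP
  have himgFS : ∀ ω, ¬ P1 ω → ¬ P2 ω → ¬ P3 ω → ¬ P4 ω → ∀ h5 : P5 ω,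
      E ω ∈ canonEnd (n + 2) ∧ IsTopLeaf (n + 2) (E ω) ∧ ¬ IsBotLeaf (n + 2) (E ω) ∧
      ∃ (L xb : ℤ) (j : ℕ) (fwd : Bool), (∀ i, i ≤ n → L ≤ ω i 1) ∧ (∀ i, i ≤ n → ω i 1 = L → ω i 0 ≤ xb) ∧
        FloorSlideDatum n ω (E ω) L xb j fwd := by
    intro ω h1 h2 h3 h4 h5
    rw [hE5 ω h1 h2 h3 h4 h5]
    obtain ⟨hW, L, xb, j, fwd, hminH, hmaxX, hdepth, hd⟩ := Classical.choose_spec (exists_floorSlide_image h5.1 h5.2.1)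
    refine ⟨hW, isTopLeaf_of_floorSlideDatum hd hdepth h5.2.2, ?_, L, xb, j, fwd, hminH, hmaxX, hd⟩
    obtain ⟨hP, -, hWeq⟩ := hd
    rw [hWeq]; exact not_isBotLeaf_spliceUb h5.1 hminH hmaxX hP
  have himgFC : ∀ ω, ¬ P1 ω → ¬ P2 ω → ¬ P3 ω → ¬ P4 ω → ¬ P5 ω → ∀ h6 : P6 ω,
      E ω ∈ canonEnd (n + 2) ∧ IsTopLeaf (n + 2) (E ω) ∧ IsBotLeaf (n + 2) (E ω) ∧
      (∃ (H xm : ℤ) (τ t : ℕ), TopSix (n + 2) (E ω) H xm τ ∧ t ≤ n + 2 ∧ E ω t = pt (xm - 3) (H - 2)) ∧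
      ∃ (L xb : ℤ) (j : ℕ) (fwd : Bool), (∀ i, i ≤ n → L ≤ ω i 1) ∧ (∀ i, i ≤ n → ω i 1 = L → ω i 0 ≤ xb) ∧
        FloorCrownDatum n ω (E ω) L xb j fwd := by
    intro ω h1 h2 h3 h4 h5 h6
    rw [hE6 ω h1 h2 h3 h4 h5 h6]
    obtain ⟨hW, L, xb, j, fwd, hminH, hmaxX, hdepth, hd⟩ := Classical.choose_spec (exists_floorCrown_image h6.1 h6.2.1)
    refine ⟨hW, isTopLeaf_of_floorCrownDatum hd hdepth (isTopLeaf_of_isTopAntenna h6.2.2), ?_,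
      antenna_topSix_of_floorCrownDatum hd hdepth h6.2.2, L, xb, j, fwd, hminH, hmaxX, hd⟩
    obtain ⟨hx2, hP, -, hWeq⟩ := hd
    rw [hWeq]; exact isBotLeaf_spliceVb hx2 hminH hmaxX hP
  have hbranch : ∀ ω, ω ∈ canonEnd n → IsStepTwoSixSlot n ω →
      P1 ω ∨ (¬ P1 ω ∧ P2 ω) ∨ (¬ P1 ω ∧ ¬ P2 ω ∧ P3 ω) ∨ (¬ P1 ω ∧ ¬ P2 ω ∧ ¬ P3 ω ∧ P4 ω) ∨
        (¬ P1 ω ∧ ¬ P2 ω ∧ ¬ P3 ω ∧ ¬ P4 ω ∧ P5 ω) ∨ (¬ P1 ω ∧ ¬ P2 ω ∧ ¬ P3 ω ∧ ¬ P4 ω ∧ ¬ P5 ω ∧ P6 ω) := by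
    intro ω hω hc
    by_cases h1 : P1 ω
    · exact Or.inl h1
    by_cases h2 : P2 ω
    · exact Or.inr (Or.inl ⟨h1, h2⟩)
    by_cases h3 : P3 ω
    · exact Or.inr (Or.inr (Or.inl ⟨h1, h2, h3⟩))
    by_cases h4 : P4 ω
    · exact Or.inr (Or.inr (Or.inr (Or.inl ⟨h1, h2, h3, h4⟩)))
    by_cases h5 : P5 ω
    · exact Or.inr (Or.inr (Or.inr (Or.inr (Or.inl ⟨h1, h2, h3, h4, h5⟩))))
    refine Or.inr (Or.inr (Or.inr (Or.inr (Or.inr ⟨h1, h2, h3, h4, h5, hω, ?_⟩))))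
    rcases hc with ((hR | ⟨hl, hb⟩) | hs | hcr) | hfs | hfc
    · exact absurd ⟨hω, hR⟩ h1
    · exact absurd ⟨hω, hl, hb⟩ h2
    · exact absurd ⟨hω, hs⟩ h3
    · exact absurd ⟨hω, hcr⟩ h4
    · exact absurd ⟨hω, hfs⟩ h5
    · exact hfc
  refine Finset.card_le_card_of_injOn E (fun ω hω => ?_) (fun ω₁ hω₁ ω₂ hω₂ heq => ?_)
  · rw [Finset.mem_coe, Finset.mem_filter] at hω
    rw [Finset.mem_coe]
    rcases hbranch ω hω.1 hω.2 with h1 | ⟨h1, h2⟩ | ⟨h1, h2, h3⟩ | ⟨h1, h2, h3, h4⟩ | ⟨h1, h2, h3, h4, h5⟩ | ⟨h1, h2, h3, h4, h5, h6⟩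
    · exact (himgR ω h1).1
    · exact (himgB ω h1 h2).1
    · exact (himgS ω h1 h2 h3).1
    · exact (himgC ω h1 h2 h3 h4).1
    · exact (himgFS ω h1 h2 h3 h4 h5).1
    · exact (himgFC ω h1 h2 h3 h4 h5 h6).1
  · rw [Finset.mem_coe, Finset.mem_filter] at hω₁ hω₂
    have hinjW : ∀ {W : ℕ → Site 2}, W ∈ canonEnd (n + 2) → Set.InjOn W {i | i ≤ n + 2} :=
      fun hW => (mem_endAt_iff.1 (mem_canonEnd.1 hW).1).1.2.2.2
    rcases hbranch ω₁ hω₁.1 hω₁.2 with a1 | ⟨a1, a2⟩ | ⟨a1, a2, a3⟩ | ⟨a1, a2, a3, a4⟩ | ⟨a1, a2, a3, a4, a5⟩ |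
        ⟨a1, a2, a3, a4, a5, a6⟩ <;>
      rcases hbranch ω₂ hω₂.1 hω₂.2 with b1 | ⟨b1, b2⟩ | ⟨b1, b2, b3⟩ | ⟨b1, b2, b3, b4⟩ | ⟨b1, b2, b3, b4, b5⟩ |
        ⟨b1, b2, b3, b4, b5, b6⟩
    -- row R
    · obtain ⟨-, -, H₁, xm₁, j₁, k₁, fwd₁, hmaxH₁, hmaxX₁, h₁⟩ := himgR ω₁ a1
      obtain ⟨-, -, H₂, xm₂, j₂, k₂, fwd₂, hmaxH₂, hmaxX₂, h₂⟩ := himgR ω₂ b1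
      rw [heq] at h₁
      exact eq_of_stepTwoRoof_image_eq hω₁.1 hω₂.1 hmaxH₁ hmaxX₁ hmaxH₂ hmaxX₂ h₁ h₂
    · exfalso
      obtain ⟨-, hnl, -⟩ := himgR ω₁ a1
      obtain ⟨-, hl, -⟩ := himgB ω₂ b1 b2
      rw [heq] at hnl; exact hnl hl
    · exfalso
      obtain ⟨-, -, H₁, xm₁, j₁, k₁, fwd₁, hmaxH₁, hmaxX₁, h₁⟩ := himgR ω₁ a1
      obtain ⟨-, -, H₂, xm₂, j₂, fwd₂, hmaxH₂, hmaxX₂, hP₂, -, hW₂⟩ := himgS ω₂ b1 b2 b3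
      rw [heq, hW₂] at h₁
      exact spliceU_ne_roof hω₂.1 hω₁.1 (by omega) hmaxH₂ hmaxX₂ hmaxH₁ hmaxX₁ hP₂ h₁
    · exfalso
      obtain ⟨-, hnl, -⟩ := himgR ω₁ a1
      obtain ⟨-, hl, -⟩ := himgC ω₂ b1 b2 b3 b4
      rw [heq] at hnl; exact hnl hl
    · exfalso
      obtain ⟨-, hnl, -⟩ := himgR ω₁ a1
      obtain ⟨-, hl, -⟩ := himgFS ω₂ b1 b2 b3 b4 b5
      rw [heq] at hnl; exact hnl hl
    · exfalso
      obtain ⟨-, hnl, -⟩ := himgR ω₁ a1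
      obtain ⟨-, hl, -⟩ := himgFC ω₂ b1 b2 b3 b4 b5 b6
      rw [heq] at hnl; exact hnl hl
    -- row B
    · exfalso
      obtain ⟨-, hnl, -⟩ := himgR ω₂ b1
      obtain ⟨-, hl, -⟩ := himgB ω₁ a1 a2
      rw [← heq] at hnl; exact hnl hl
    · obtain ⟨-, -, -, L₁, xb₁, j₁, k₁, fwd₁, hminH₁, hmaxX₁, h₁⟩ := himgB ω₁ a1 a2
      obtain ⟨-, -, -, L₂, xb₂, j₂, k₂, fwd₂, hminH₂, hmaxX₂, h₂⟩ := himgB ω₂ b1 b2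
      rw [heq] at h₁
      exact eq_of_stepTwoBottom_image_eq hω₁.1 hω₂.1 hminH₁ hmaxX₁ hminH₂ hmaxX₂ h₁ h₂
    · exfalso
      obtain ⟨-, hl, -⟩ := himgB ω₁ a1 a2
      obtain ⟨-, hnl, -⟩ := himgS ω₂ b1 b2 b3
      rw [heq] at hl; exact hnl hl
    · exfalso
      obtain ⟨-, -, hnb, -⟩ := himgB ω₁ a1 a2
      obtain ⟨-, -, hbl, -⟩ := himgC ω₂ b1 b2 b3 b4
      rw [heq] at hnb; exact hnb hbl
    · exfalso
      obtain ⟨-, -, -, L₁, xb₁, j₁, k₁, fwd₁, hminH₁, hmaxX₁, h₁⟩ := himgB ω₁ a1 a2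
      obtain ⟨-, -, -, L₂, xb₂, j₂, fwd₂, hminH₂, hmaxX₂, hP₂, -, hW₂⟩ := himgFS ω₂ b1 b2 b3 b4 b5
      rw [heq, hW₂] at h₁
      exact spliceUb_ne_bottom hω₂.1 hω₁.1 hminH₂ hmaxX₂ hminH₁ hmaxX₁ hP₂ h₁
    · exfalso
      obtain ⟨-, -, hnb, -⟩ := himgB ω₁ a1 a2
      obtain ⟨-, -, hbl, -⟩ := himgFC ω₂ b1 b2 b3 b4 b5 b6
      rw [heq] at hnb; exact hnb hbl
    -- row S
    · exfalso
      obtain ⟨-, -, H₂, xm₂, j₂, k₂, fwd₂, hmaxH₂, hmaxX₂, h₂⟩ := himgR ω₂ b1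
      obtain ⟨-, -, H₁, xm₁, j₁, fwd₁, hmaxH₁, hmaxX₁, hP₁, -, hW₁⟩ := himgS ω₁ a1 a2 a3
      rw [← heq, hW₁] at h₂
      exact spliceU_ne_roof hω₁.1 hω₂.1 (by omega) hmaxH₁ hmaxX₁ hmaxH₂ hmaxX₂ hP₁ h₂
    · exfalso
      obtain ⟨-, hnl, -⟩ := himgS ω₁ a1 a2 a3
      obtain ⟨-, hl, -⟩ := himgB ω₂ b1 b2
      rw [heq] at hnl; exact hnl hl
    · obtain ⟨-, -, H₁, xm₁, j₁, fwd₁, hmaxH₁, hmaxX₁, h₁⟩ := himgS ω₁ a1 a2 a3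
      obtain ⟨-, -, H₂, xm₂, j₂, fwd₂, hmaxH₂, hmaxX₂, h₂⟩ := himgS ω₂ b1 b2 b3
      rw [heq] at h₁
      exact eq_of_leafSlide_image_eq hω₁.1 hω₂.1 hmaxH₁ hmaxX₁ hmaxH₂ hmaxX₂ h₁ h₂
    · exfalso
      obtain ⟨-, hnl, -⟩ := himgS ω₁ a1 a2 a3
      obtain ⟨-, hl, -⟩ := himgC ω₂ b1 b2 b3 b4
      rw [heq] at hnl; exact hnl hl
    · exfalso
      obtain ⟨-, hnl, -⟩ := himgS ω₁ a1 a2 a3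
      obtain ⟨-, hl, -⟩ := himgFS ω₂ b1 b2 b3 b4 b5
      rw [heq] at hnl; exact hnl hl
    · exfalso
      obtain ⟨-, hnl, -⟩ := himgS ω₁ a1 a2 a3
      obtain ⟨-, hl, -⟩ := himgFC ω₂ b1 b2 b3 b4 b5 b6
      rw [heq] at hnl; exact hnl hl
    -- row C
    · exfalso
      obtain ⟨-, hnl, -⟩ := himgR ω₂ b1
      obtain ⟨-, hl, -⟩ := himgC ω₁ a1 a2 a3 a4
      rw [← heq] at hnl; exact hnl hl
    · exfalso
      obtain ⟨-, -, hbl, -⟩ := himgC ω₁ a1 a2 a3 a4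
      obtain ⟨-, -, hnb, -⟩ := himgB ω₂ b1 b2
      rw [heq] at hbl; exact hnb hbl
    · exfalso
      obtain ⟨-, hl, -⟩ := himgC ω₁ a1 a2 a3 a4
      obtain ⟨-, hnl, -⟩ := himgS ω₂ b1 b2 b3
      rw [heq] at hl; exact hnl hl
    · obtain ⟨-, -, -, H₁, xm₁, j₁, fwd₁, hmaxH₁, hmaxX₁, h₁⟩ := himgC ω₁ a1 a2 a3 a4
      obtain ⟨-, -, -, H₂, xm₂, j₂, fwd₂, hmaxH₂, hmaxX₂, h₂⟩ := himgC ω₂ b1 b2 b3 b4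
      rw [heq] at h₁
      exact eq_of_leafCrown_image_eq hω₁.1 hω₂.1 hmaxH₁ hmaxX₁ hmaxH₂ hmaxX₂ h₁ h₂
    · exfalso
      obtain ⟨-, -, hbl, -⟩ := himgC ω₁ a1 a2 a3 a4
      obtain ⟨-, -, hnb, -⟩ := himgFS ω₂ b1 b2 b3 b4 b5
      rw [heq] at hbl; exact hnb hbl
    · -- crown vs floor-crown: the crown image avoids `(x′−3, H′−2)`, the floor-crown image of an antenna carries it
      exfalso
      obtain ⟨hW₁, -, -, H₁, xm₁, j₁, fwd₁, hmaxH₁, hmaxX₁, hx2, hP₁, hw₁, hWeq₁⟩ := himgC ω₁ a1 a2 a3 a4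
      obtain ⟨-, -, -, ⟨H₂, xm₂, τ, t, T₂, ht, e⟩, -⟩ := himgFC ω₂ b1 b2 b3 b4 b5 b6
      have T₁ := topAt_spliceV hmaxH₁ hmaxX₁ hP₁
      rw [← hWeq₁] at T₁
      rw [← heq] at T₂ e
      obtain ⟨eH, ex, -⟩ := topAt_unique (hinjW hW₁) T₁ T₂
      rw [hWeq₁] at e
      exact spliceV_free_mid (mem_canonEnd.1 hω₁.1).1 hP₁ hw₁ t ht (by rw [e]; exact pt_inj.2 ⟨by omega, by omega⟩)
    -- row FS
    · exfalso
      obtain ⟨-, hnl, -⟩ := himgR ω₂ b1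
      obtain ⟨-, hl, -⟩ := himgFS ω₁ a1 a2 a3 a4 a5
      rw [← heq] at hnl; exact hnl hl
    · exfalso
      obtain ⟨-, -, -, L₂, xb₂, j₂, k₂, fwd₂, hminH₂, hmaxX₂, h₂⟩ := himgB ω₂ b1 b2
      obtain ⟨-, -, -, L₁, xb₁, j₁, fwd₁, hminH₁, hmaxX₁, hP₁, -, hW₁⟩ := himgFS ω₁ a1 a2 a3 a4 a5
      rw [← heq, hW₁] at h₂
      exact spliceUb_ne_bottom hω₁.1 hω₂.1 hminH₁ hmaxX₁ hminH₂ hmaxX₂ hP₁ h₂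
    · exfalso
      obtain ⟨-, hl, -⟩ := himgFS ω₁ a1 a2 a3 a4 a5
      obtain ⟨-, hnl, -⟩ := himgS ω₂ b1 b2 b3
      rw [heq] at hl; exact hnl hl
    · exfalso
      obtain ⟨-, -, hnb, -⟩ := himgFS ω₁ a1 a2 a3 a4 a5
      obtain ⟨-, -, hbl, -⟩ := himgC ω₂ b1 b2 b3 b4
      rw [heq] at hnb; exact hnb hbl
    · obtain ⟨-, -, -, L₁, xb₁, j₁, fwd₁, hminH₁, hmaxX₁, h₁⟩ := himgFS ω₁ a1 a2 a3 a4 a5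
      obtain ⟨-, -, -, L₂, xb₂, j₂, fwd₂, hminH₂, hmaxX₂, h₂⟩ := himgFS ω₂ b1 b2 b3 b4 b5
      rw [heq] at h₁
      exact eq_of_floorSlide_image_eq hω₁.1 hω₂.1 hminH₁ hmaxX₁ hminH₂ hmaxX₂ h₁ h₂
    · exfalso
      obtain ⟨-, -, hnb, -⟩ := himgFS ω₁ a1 a2 a3 a4 a5
      obtain ⟨-, -, hbl, -⟩ := himgFC ω₂ b1 b2 b3 b4 b5 b6
      rw [heq] at hnb; exact hnb hbl
    -- row FC
    · exfalso
      obtain ⟨-, hnl, -⟩ := himgR ω₂ b1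
      obtain ⟨-, hl, -⟩ := himgFC ω₁ a1 a2 a3 a4 a5 a6
      rw [← heq] at hnl; exact hnl hl
    · exfalso
      obtain ⟨-, -, hbl, -⟩ := himgFC ω₁ a1 a2 a3 a4 a5 a6
      obtain ⟨-, -, hnb, -⟩ := himgB ω₂ b1 b2
      rw [heq] at hbl; exact hnb hbl
    · exfalso
      obtain ⟨-, hl, -⟩ := himgFC ω₁ a1 a2 a3 a4 a5 a6
      obtain ⟨-, hnl, -⟩ := himgS ω₂ b1 b2 b3
      rw [heq] at hl; exact hnl hl
    · exfalso
      obtain ⟨hW₂, -, -, H₂, xm₂, j₂, fwd₂, hmaxH₂, hmaxX₂, hx2, hP₂, hw₂, hWeq₂⟩ := himgC ω₂ b1 b2 b3 b4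
      obtain ⟨-, -, -, ⟨H₁, xm₁, τ, t, T₁, ht, e⟩, -⟩ := himgFC ω₁ a1 a2 a3 a4 a5 a6
      have T₂ := topAt_spliceV hmaxH₂ hmaxX₂ hP₂
      rw [← hWeq₂] at T₂
      rw [heq] at T₁ e
      obtain ⟨eH, ex, -⟩ := topAt_unique (hinjW hW₂) T₂ T₁
      rw [hWeq₂] at e
      exact spliceV_free_mid (mem_canonEnd.1 hω₂.1).1 hP₂ hw₂ t ht (by rw [e]; exact pt_inj.2 ⟨by omega, by omega⟩)
    · exfalso
      obtain ⟨-, -, hbl, -⟩ := himgFC ω₁ a1 a2 a3 a4 a5 a6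
      obtain ⟨-, -, hnb, -⟩ := himgFS ω₂ b1 b2 b3 b4 b5
      rw [heq] at hbl; exact hnb hbl
    · obtain ⟨-, -, -, -, L₁, xb₁, j₁, fwd₁, hminH₁, hmaxX₁, h₁⟩ := himgFC ω₁ a1 a2 a3 a4 a5 a6
      obtain ⟨-, -, -, -, L₂, xb₂, j₂, fwd₂, hminH₂, hmaxX₂, h₂⟩ := himgFC ω₂ b1 b2 b3 b4 b5 b6
      rw [heq] at h₁
      exact eq_of_floorCrown_image_eq hω₁.1 hω₂.1 hminH₁ hmaxX₁ hminH₂ hmaxX₂ h₁ h₂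

/-- **Complement form**: `#canonEnd n − #{six-slot residue} ≤ #canonEnd (n+2)`. [cite: MadrasSlade1993, §3.2, Theorem 3.2.3 / (3.2.3)] -/
theorem card_canonEnd_sub_card_filter_sixSlotResidue_le [DecidablePred (IsStepTwoSixSlot n)]
    [DecidablePred fun ω => IsTopLeaf n ω ∧ ¬ IsStepTwoBottom n ω ∧ ¬ IsLeafSlide n ω ∧ ¬ (IsLeafCrown n ω ∧ IsBotLeaf n ω) ∧
      ¬ IsFloorSlide n ω ∧ ¬ (IsFloorCrown n ω ∧ IsTopAntenna n ω)] (hn : 5 ≤ n) :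
    #(canonEnd n) - #((canonEnd n).filter fun ω => IsTopLeaf n ω ∧ ¬ IsStepTwoBottom n ω ∧ ¬ IsLeafSlide n ω ∧
        ¬ (IsLeafCrown n ω ∧ IsBotLeaf n ω) ∧ ¬ IsFloorSlide n ω ∧ ¬ (IsFloorCrown n ω ∧ IsTopAntenna n ω)) ≤
      #(canonEnd (n + 2)) := by
  classical
  have hcover : canonEnd n ⊆ (canonEnd n).filter (IsStepTwoSixSlot n) ∪
      (canonEnd n).filter (fun ω => IsTopLeaf n ω ∧ ¬ IsStepTwoBottom n ω ∧ ¬ IsLeafSlide n ω ∧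
        ¬ (IsLeafCrown n ω ∧ IsBotLeaf n ω) ∧ ¬ IsFloorSlide n ω ∧ ¬ (IsFloorCrown n ω ∧ IsTopAntenna n ω)) := by
    intro ω hω
    rcases isStepTwoRoof_or_isTopLeaf hω hn with h | h
    · exact Finset.mem_union_left _ (Finset.mem_filter.2 ⟨hω, Or.inl (Or.inl (Or.inl h))⟩)
    · by_cases hb : IsStepTwoBottom n ω
      · exact Finset.mem_union_left _ (Finset.mem_filter.2 ⟨hω, Or.inl (Or.inl (Or.inr ⟨h, hb⟩))⟩)
      · by_cases hs : IsLeafSlide n ω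
        · exact Finset.mem_union_left _ (Finset.mem_filter.2 ⟨hω, Or.inl (Or.inr (Or.inl hs))⟩)
        · by_cases hc : IsLeafCrown n ω ∧ IsBotLeaf n ω
          · exact Finset.mem_union_left _ (Finset.mem_filter.2 ⟨hω, Or.inl (Or.inr (Or.inr hc))⟩)
          · by_cases hfs : IsFloorSlide n ω
            · exact Finset.mem_union_left _ (Finset.mem_filter.2 ⟨hω, Or.inr (Or.inl ⟨hfs, h⟩)⟩)
            · by_cases hfc : IsFloorCrown n ω ∧ IsTopAntenna n ω
              · exact Finset.mem_union_left _ (Finset.mem_filter.2 ⟨hω, Or.inr (Or.inr hfc)⟩)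
              · exact Finset.mem_union_right _ (Finset.mem_filter.2 ⟨hω, h, hb, hs, hc, hfs, hfc⟩)
  have h1 := (Finset.card_le_card hcover).trans (Finset.card_union_le _ _)
  have h2 := card_filter_isStepTwoSixSlot_le (n := n) hn
  omega

/-- **Printed normalisation**: `q_{n+1}(ℍ) − #{six-slot residue} ≤ q_{n+3}(ℍ)` (`n ≥ 5`). [cite: MadrasSlade1993, §3.2, Theorem 3.2.3 / (3.2.3)] -/
theorem hexPolygonNumber_sub_card_sixSlotResidue_le
    [DecidablePred fun ω => IsTopLeaf n ω ∧ ¬ IsStepTwoBottom n ω ∧ ¬ IsLeafSlide n ω ∧ ¬ (IsLeafCrown n ω ∧ IsBotLeaf n ω) ∧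
      ¬ IsFloorSlide n ω ∧ ¬ (IsFloorCrown n ω ∧ IsTopAntenna n ω)] (hn : 5 ≤ n) :
    hexPolygonNumber (n + 1) - #((canonEnd n).filter fun ω => IsTopLeaf n ω ∧ ¬ IsStepTwoBottom n ω ∧ ¬ IsLeafSlide n ω ∧
        ¬ (IsLeafCrown n ω ∧ IsBotLeaf n ω) ∧ ¬ IsFloorSlide n ω ∧ ¬ (IsFloorCrown n ω ∧ IsTopAntenna n ω)) ≤
      hexPolygonNumber (n + 3) := by
  classical
  have h := card_canonEnd_sub_card_filter_sixSlotResidue_le (n := n) hn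
  rw [card_canonEnd (by omega), card_canonEnd (by omega)] at h
  exact h

end SixSlot

end PolygonConcat

end HexBW

end Literature.Probability.RandomPlanarGeometry.SAW

end
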